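import Summits.KontsevichZagierPeriods.KontsevichZagierPeriods.Theorems.TerasomaMultiplicationGammaHodgeSectorPowerIdentity

/-!
# `GammaHodgeSector` (stmt-KontsevichZagierPeriods-3742), instance line `InstanceSixtySix`:
stub `stub_certificateLift` — from a Koblitz–Ogus certificate to the relator span

At an even level `D`, a level-`D` element `v` of the Beta symbol group `ℤ[ℚ × ℚ]` of Hodge
weight `0` whose class vector `clD D v : ℤ/D → ℤ` lies in the Koblitz–Ogus span `koSpan D`
(reflection and distribution vectors) lies in the span `RelSpan` of the standard Beta relators.
Composition of the landed stubs of the line `koblitz-ogus-halving`: `stub_spanLift` produces a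
level-`D` symbol `s` with the same class vector, congruent to `e • [½,½]` modulo `RelSpan`;
`stub_kernel` puts `v - s` in `RelSpan`; the weight kills `RelSpan` (third component of
`stub_hodgeArithmetic`, at the empty datum) and `weight [½,½] = 2`, so `e = 0`.

Reference: P. Deligne, *Hodge cycles on abelian varieties*, LNM 900 (1982), §7, Rem. 7.16 (a)
(appendix by Koblitz–Ogus).
-/

noncomputable section

open scoped BigOperators

namespace Summit.KontsevichZagierPeriods.GammaHodgeSectorRaise66

open Literature.NumberTheory.Transcendental Literature.NumberTheory.Transcendental.BetaSymbol
open Summit.KontsevichZagierPeriods.GammaHodgeSectorKO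
open Summit.KontsevichZagierPeriods.GammaHodgeSectorNegative

/-- **Certificate lift.** At an even level `D`, a level-`D` symbol of weight `0` whose class
vector lies in the Koblitz–Ogus span lies in the span of the standard relators
(`stub_spanLift` + `stub_kernel`, the multiple of `[½,½]` being pinned to `0` by the weight).
[folklore] -/
theorem stub_certificateLift (D : ℕ) [NeZero D] (h2 : 2 ∣ D) (v : BSym) (hv : v ∈ levelSym D)
    (hko : clD D v ∈ koSpan D) (hw : weight v = 0) : v ∈ RelSpan := by
  obtain ⟨s, hs, hcl, e, he⟩ := stub_spanLift D h2 (clD D v) hko ⟨v, hv, rfl⟩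
  have hker : v - s ∈ RelSpan :=
    stub_kernel D (v - s) (sub_mem hv hs) (by rw [map_sub, hcl, sub_self])
  have hmem : v - e • bsym (1 / 2) (1 / 2) ∈ RelSpan := by
    have := add_mem hker he
    rwa [sub_add_sub_cancel] at this
  -- the weight kills `RelSpan` (third component of `stub_hodgeArithmetic` at the empty datum)
  obtain ⟨-, -, hwrel⟩ := stub_hodgeArithmetic (N := 0) (N' := 0) (k := 0)
    Fin.elim0 Fin.elim0 Fin.elim0 Fin.elim0 admissible_elim0 admissible_elim0 hodgeCondition_empty
    1 (fun j => j.elim0) (fun l => l.elim0)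
  have hw0 := hwrel _ hmem
  rw [map_sub, map_zsmul, weight_betaHalf, hw, smul_eq_mul, zero_sub, neg_eq_zero] at hw0
  have he0 : e = 0 := by
    rcases mul_eq_zero.mp hw0 with h | h
    · exact h
    · exact absurd h two_ne_zero
  rw [he0, zero_smul, sub_zero] at hmem
  exact hmem

end Summit.KontsevichZagierPeriods.GammaHodgeSectorRaise66

end
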